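/-
Copyright (c) 2026. All rights reserved.
Released under Apache 2.0 license as described in the file LICENSE.
Authors: abc-iut cell, prover seat abc-iut-w5-d144 (gen 6; row «IDRIGID-COVER-INHERITANCE», abstract half).
-/
import Literature.AnabelianGeometry.AbsoluteAnabelian.IdRigidEpiCoverDescent
import Mathlib.CategoryTheory.Galois.GaloisObjects
import HarnessLib

/-!
# Id-rigidity of «objects mapping to `X`» descends to «objects mapping to `X'`» along Galois descent data

PROOF-ONLY file (abc-iut cell, campaign-L item R1.2 of the `EA` column of [AbsTopIII] Prop 4.2 (i) /
Cor 4.5; seat abc-iut-w5-d144 gen 6).  S. Mochizuki, *Topics in Absolute Anabelian Geometry III*, proof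
of Prop 4.2 (i), kurims p.106 l.11–19: «for any object `X ∈ Ob(EA)` … the full subcategory of `EA`
consisting of objects that map to `X` … [is id-rigid]».  This file isolates the ABSTRACT category theory
by which that id-rigidity is INHERITED by «objects mapping to `X'`» for an object `X'` mapping to `X`
(in the cell's geometric model `HolRS`: by every finite étale cover `X' → X`), given GALOIS DESCENT DATA:

* (E)    every morphism out of an object mapping to `X'` is an epimorphism;
* (DESC) every `W` mapping to `X` receives a morphism `q : B ⟶ W` from an object `B` mapping to `X'`
         along which every automorphism `τ` of `B` commuting with `End B` DESCENDS
         (`q ≫ e = τ ≫ q` for some `e : W ⟶ W`);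
* (DOM)  any two morphisms `g₁ : B₁ ⟶ W`, `g₂ : B₂ ⟶ W` (`W` mapping to `X`, `Bᵢ` mapping to `X'`) are
         jointly DOMINATED: `d ≫ r₁ ≫ g₁ = r₂ ≫ g₂` for some `B₃` mapping to `X'`, `rᵢ : B₃ ⟶ Bᵢ`
         and an endomorphism `d` of `B₃`.

In `HolRS` (sequel file `ArchimedeanHolFieldFunctorGeometricCoverInheritance`), `B`, `B₃` are Galois
finite étale coverings of `X` dominating the given objects, (DESC) is descent along a Galois covering
and (DOM) is the transitivity of the deck group on morphisms out of a Galois object.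

* `exists_iso_hom_comp_eq_of_isGalois` — in any Galois category, `Aut A` is TRANSITIVE on `Hom(A, Y)` for `A`
  Galois and `Y` connected (the source of (DOM) in `HolRS`; Mathlib states the transitivity on fibres only).
* `isIdRigid_mapsTo_of_galois_descent` — **(E) + (DESC) + (DOM) + «mapsTo `X`» id-rigid ⇒
  «mapsTo `X'`» id-rigid**: an automorphism `α` of the identity functor of `{Y | Nonempty (Y ⟶ X')}`
  EXTENDS to one of `{W | Nonempty (W ⟶ X)}` (descend `α_B` along `q : B ⟶ W`; independence of
  choices and naturality by (DOM) and cancelling epimorphisms), whose triviality forces `α = 1`.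

Pure category theory (any category / any Galois category); no definition, no instance, no Prop-valued fact; classical;
nothing here bears on [IUTchIII] Cor. 3.12; model ≠ reconstruction; support library, not a node.

## References

* S. Mochizuki, *Topics in Absolute Anabelian Geometry III*, kurims ms, §0 p.27 (id-rigid categories),
  proof of Prop 4.2 (i) p.106 l.11–19. [MochizukiAbsTopIII2015]
* A. Grothendieck, M. Raynaud, SGA 1, Exp. V §4–§5 (Galois objects; descent along Galois covers). [SGA1]
-/

namespace Literature.AnabelianGeometry.AbsoluteAnabelian

open _root_.CategoryTheory _root_.CategoryTheory.PreGaloisCategory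

universe v u

variable {C : Type u} [Category.{v} C]

/-- The `C`-level component of an automorphism of `𝟭` on a full subcategory commutes with every
endomorphism of the underlying object (naturality along the endomorphism, which lies in the FULL
subcategory). [cite: MochizukiAbsTopIII2015, Section 0 p.27] -/
theorem ι_mapIso_app_comm {P : ObjectProperty C} (α : 𝟭 P.FullSubcategory ≅ 𝟭 P.FullSubcategory)
    (B : P.FullSubcategory) (u : B.obj ⟶ B.obj) :
    ((ObjectProperty.ι P).mapIso (α.app B)).hom ≫ u = u ≫ ((ObjectProperty.ι P).mapIso (α.app B)).hom := by
  have h := α.hom.naturality (X := B) (Y := B) (ObjectProperty.homMk u)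
  have h' := congrArg InducedCategory.Hom.hom h
  simp only [Functor.id_obj, Functor.id_map, ObjectProperty.FullSubcategory.comp_hom,
    ObjectProperty.homMk_hom] at h'
  simpa using h'.symm

/-- The `C`-level components of an automorphism of `𝟭` on a full subcategory are natural along every
morphism of `C` between objects of the subcategory. [cite: MochizukiAbsTopIII2015, Section 0 p.27] -/
theorem ι_mapIso_app_naturality {P : ObjectProperty C} (α : 𝟭 P.FullSubcategory ≅ 𝟭 P.FullSubcategory)
    (B₁ B₂ : P.FullSubcategory) (r : B₁.obj ⟶ B₂.obj) :
    ((ObjectProperty.ι P).mapIso (α.app B₁)).hom ≫ r =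
      r ≫ ((ObjectProperty.ι P).mapIso (α.app B₂)).hom := by
  have h := α.hom.naturality (X := B₁) (Y := B₂) (ObjectProperty.homMk r)
  have h' := congrArg InducedCategory.Hom.hom h
  simp only [Functor.id_obj, Functor.id_map, ObjectProperty.FullSubcategory.comp_hom,
    ObjectProperty.homMk_hom] at h'
  simpa using h'.symm

/-- **Id-rigidity of «objects mapping to `X`» is inherited by «objects mapping to `X'`» along Galois
descent data** (`p : X' ⟶ X`).  Hypotheses: (E) morphisms out of objects mapping to `X'` are
epimorphisms; (DESC) every `W` mapping to `X` receives `q : B ⟶ W` from some `B` mapping to `X'` along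
which every automorphism of `B` commuting with `End B` descends; (DOM) two morphisms `g₁ : B₁ ⟶ W`,
`g₂ : B₂ ⟶ W` from objects mapping to `X'` into an object mapping to `X` satisfy `d ≫ r₁ ≫ g₁ = r₂ ≫ g₂`
for some `B₃` mapping to `X'`, `rᵢ : B₃ ⟶ Bᵢ`, `d : B₃ ⟶ B₃`.  Conclusion: if `{W | Nonempty (W ⟶ X)}`
is id-rigid then so is `{Y | Nonempty (Y ⟶ X')}`.  Proof: an automorphism `α` of `𝟭_{mapsTo X'}` is
extended to `𝟭_{mapsTo X}` by descending `α_B` along the `q` of (DESC); by (DOM), naturality of `α` and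
(E) any two descended endomorphisms are compatible with every `f : W₁ ⟶ W₂` — this gives at once the
naturality of the extension and, with `f = 𝟙`, that it restricts to `α`; id-rigidity over `X` kills it.
[cite: MochizukiAbsTopIII2015, Proposition 4.2 (i) p.106] [cite: SGA1, Exp. V §5] -/
theorem isIdRigid_mapsTo_of_galois_descent {X X' : C} (p : X' ⟶ X)
    (hepi : ∀ ⦃B W : C⦄, Nonempty (B ⟶ X') → ∀ f : B ⟶ W, Epi f)
    (hdesc : ∀ W : C, Nonempty (W ⟶ X) →
      ∃ (B : C) (_ : Nonempty (B ⟶ X')) (q : B ⟶ W),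
        ∀ τ : B ≅ B, (∀ u : B ⟶ B, τ.hom ≫ u = u ≫ τ.hom) → ∃ e : W ⟶ W, q ≫ e = τ.hom ≫ q)
    (hdom : ∀ (W B₁ B₂ : C), Nonempty (W ⟶ X) → Nonempty (B₁ ⟶ X') → Nonempty (B₂ ⟶ X') →
      ∀ (g₁ : B₁ ⟶ W) (g₂ : B₂ ⟶ W),
        ∃ (B₃ : C) (_ : Nonempty (B₃ ⟶ X')) (r₁ : B₃ ⟶ B₁) (r₂ : B₃ ⟶ B₂) (d : B₃ ⟶ B₃),
          d ≫ r₁ ≫ g₁ = r₂ ≫ g₂)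
    (h : IsIdRigid (ObjectProperty.FullSubcategory fun W : C => Nonempty (W ⟶ X))) :
    IsIdRigid (ObjectProperty.FullSubcategory fun Y : C => Nonempty (Y ⟶ X')) := by
  classical
  refine isRigidFunctor_of_hom_app_eq_id fun α Y => ?_
  -- the `C`-level components of `α` at objects mapping to `X'`
  let a : ∀ B : C, Nonempty (B ⟶ X') → (B ≅ B) := fun B hB =>
    (ObjectProperty.ι _).mapIso (α.app (⟨B, hB⟩ : ObjectProperty.FullSubcategory fun Y : C =>
      Nonempty (Y ⟶ X')))
  have a_comm : ∀ (B : C) (hB : Nonempty (B ⟶ X')) (u : B ⟶ B),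
      (a B hB).hom ≫ u = u ≫ (a B hB).hom := fun B hB u => ι_mapIso_app_comm α ⟨B, hB⟩ u
  have a_nat : ∀ (B₁ : C) (hB₁ : Nonempty (B₁ ⟶ X')) (B₂ : C) (hB₂ : Nonempty (B₂ ⟶ X'))
      (r : B₁ ⟶ B₂), (a B₁ hB₁).hom ≫ r = r ≫ (a B₂ hB₂).hom := fun B₁ hB₁ B₂ hB₂ r =>
    ι_mapIso_app_naturality α ⟨B₁, hB₁⟩ ⟨B₂, hB₂⟩ r
  -- COMPARISON: any two descended endomorphisms are compatible with every `f : W₁ ⟶ W₂`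
  have cmp : ∀ (W₁ W₂ : C) (_ : Nonempty (W₂ ⟶ X)) (f : W₁ ⟶ W₂)
      (B₁ : C) (hB₁ : Nonempty (B₁ ⟶ X')) (q₁ : B₁ ⟶ W₁) (e₁ : W₁ ⟶ W₁)
      (_ : q₁ ≫ e₁ = (a B₁ hB₁).hom ≫ q₁)
      (B₂ : C) (hB₂ : Nonempty (B₂ ⟶ X')) (q₂ : B₂ ⟶ W₂) (e₂ : W₂ ⟶ W₂)
      (_ : q₂ ≫ e₂ = (a B₂ hB₂).hom ≫ q₂), f ≫ e₂ = e₁ ≫ f := by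
    intro W₁ W₂ hW₂ f B₁ hB₁ q₁ e₁ he₁ B₂ hB₂ q₂ e₂ he₂
    obtain ⟨B₃, hB₃, r₁, r₂, d, hd⟩ := hdom W₂ B₁ B₂ hW₂ hB₁ hB₂ (q₁ ≫ f) q₂
    haveI : Epi (d ≫ r₁ ≫ q₁) := hepi hB₃ _
    rw [← cancel_epi (d ≫ r₁ ≫ q₁)]
    calc (d ≫ r₁ ≫ q₁) ≫ f ≫ e₂ = (d ≫ r₁ ≫ q₁ ≫ f) ≫ e₂ := by simp only [Category.assoc]
      _ = (r₂ ≫ q₂) ≫ e₂ := by rw [hd]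
      _ = r₂ ≫ (a B₂ hB₂).hom ≫ q₂ := by rw [Category.assoc, he₂]
      _ = ((a B₃ hB₃).hom ≫ r₂) ≫ q₂ := by rw [a_nat B₃ hB₃ B₂ hB₂ r₂, Category.assoc]
      _ = (a B₃ hB₃).hom ≫ d ≫ r₁ ≫ q₁ ≫ f := by rw [Category.assoc, ← hd]
      _ = ((a B₃ hB₃).hom ≫ d) ≫ r₁ ≫ q₁ ≫ f := by rw [Category.assoc]
      _ = d ≫ ((a B₃ hB₃).hom ≫ r₁) ≫ q₁ ≫ f := by rw [a_comm B₃ hB₃ d, Category.assoc, Category.assoc]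
      _ = d ≫ r₁ ≫ ((a B₁ hB₁).hom ≫ q₁) ≫ f := by rw [a_nat B₃ hB₃ B₁ hB₁ r₁, Category.assoc, Category.assoc]
      _ = d ≫ r₁ ≫ (q₁ ≫ e₁) ≫ f := by rw [he₁]
      _ = (d ≫ r₁ ≫ q₁) ≫ e₁ ≫ f := by simp only [Category.assoc]
  -- CHOSEN descent data for every `W` mapping to `X`
  choose B hB q H using hdesc
  have hsymm : ∀ (W : C) (hW : Nonempty (W ⟶ X)) (u : B W hW ⟶ B W hW),
      (a (B W hW) (hB W hW)).symm.hom ≫ u = u ≫ (a (B W hW) (hB W hW)).symm.hom := by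
    intro W hW u
    rw [Iso.symm_hom, Iso.inv_comp_eq, ← Category.assoc, a_comm, Category.assoc, Iso.hom_inv_id,
      Category.comp_id]
  choose e he using fun W hW => H W hW (a (B W hW) (hB W hW)) (a_comm _ _)
  choose e' he' using fun W hW => H W hW (a (B W hW) (hB W hW)).symm (hsymm W hW)
  have hee' : ∀ W hW, e W hW ≫ e' W hW = 𝟙 W := by
    intro W hW
    haveI : Epi (q W hW) := hepi (hB W hW) _
    rw [← cancel_epi (q W hW), ← Category.assoc, he, Category.assoc, he', Iso.symm_hom,
      Iso.hom_inv_id_assoc, Category.comp_id]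
  have he'e : ∀ W hW, e' W hW ≫ e W hW = 𝟙 W := by
    intro W hW
    haveI : Epi (q W hW) := hepi (hB W hW) _
    rw [← cancel_epi (q W hW), ← Category.assoc, he', Category.assoc, he, Iso.symm_hom,
      Iso.inv_hom_id_assoc, Category.comp_id]
  -- the EXTENSION `β` of `α` to «objects mapping to `X`»
  let β : 𝟭 (ObjectProperty.FullSubcategory fun W : C => Nonempty (W ⟶ X)) ≅ 𝟭 _ :=
    NatIso.ofComponents
      (fun W => ObjectProperty.isoMk _
        { hom := e W.obj W.property
          inv := e' W.obj W.property
          hom_inv_id := hee' W.obj W.property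
          inv_hom_id := he'e W.obj W.property })
      (fun {W₁ W₂} f => by
        apply ObjectProperty.hom_ext
        simp only [Functor.id_obj, Functor.id_map, ObjectProperty.FullSubcategory.comp_hom,
          ObjectProperty.isoMk_hom]
        exact cmp W₁.obj W₂.obj W₂.property f.hom (B W₁.obj W₁.property) (hB _ _) (q _ _) (e _ _)
          (he _ _) (B W₂.obj W₂.property) (hB _ _) (q _ _) (e _ _) (he _ _))
  -- id-rigidity over `X` kills `β`
  obtain ⟨y⟩ := Y.property
  have hY : Nonempty (Y.obj ⟶ X) := ⟨y ≫ p⟩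
  have hβY : β.hom.app ⟨Y.obj, hY⟩ = 𝟙 _ := h.hom_app_eq_id β ⟨Y.obj, hY⟩
  have heY : e Y.obj hY = 𝟙 Y.obj := by
    have h1 := congrArg InducedCategory.Hom.hom hβY
    simpa [β] using h1
  -- and `β` restricts to `α`: compare the data `(Y, 𝟙, α_Y)` with the chosen data for `Y`
  have hres := cmp Y.obj Y.obj hY (𝟙 Y.obj) Y.obj Y.property (𝟙 Y.obj) (a Y.obj Y.property).hom
    (by rw [Category.id_comp, Category.comp_id]) (B Y.obj hY) (hB _ _) (q _ _) (e _ _) (he _ _)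
  rw [Category.id_comp, Category.comp_id, heY] at hres
  -- `hres : 𝟙 Y.obj = (a Y.obj Y.property).hom`
  apply ObjectProperty.hom_ext
  have haY : (a Y.obj Y.property).hom = (α.hom.app Y).hom := rfl
  show (α.hom.app Y).hom = 𝟙 Y.obj
  rw [← haY, ← hres]

/-! ### Galois categories: morphisms out of a Galois object into a connected object form ONE `Aut`-orbit
(the transitivity behind (DOM)) -/

section GaloisTransitive

variable {C : Type u} [Category.{v} C] [GaloisCategory C]

/-- **Transitivity of `Aut A` on `Hom(A, Y)`** for `A` Galois and `Y` connected: any two morphisms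
`f g : A ⟶ Y` differ by an automorphism of `A` (`σ ≫ g = f`).  (Fibre functor `F`: `F.map g` is
surjective onto `F.obj Y`, `Aut A` is transitive on `F.obj A`, and morphisms out of the connected `A` are
determined by the image of one fibre point.) [cite: SGA1, Exp. V §5] -/
theorem exists_iso_hom_comp_eq_of_isGalois {A Y : C} [IsGalois A] [IsConnected Y] (f g : A ⟶ Y) :
    ∃ σ : A ≅ A, σ.hom ≫ g = f := by
  let F := GaloisCategory.getFiberFunctor C
  obtain ⟨a⟩ := nonempty_fiber_of_isConnected F A
  obtain ⟨a', ha'⟩ := surjective_of_nonempty_fiber_of_isConnected F g (F.map f a)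
  obtain ⟨σ, (hσ : F.map σ.hom a = a')⟩ := MulAction.exists_smul_eq (Aut A) a a'
  refine ⟨σ, evaluation_injective_of_isConnected F A Y a ?_⟩
  show F.map (σ.hom ≫ g) a = F.map f a
  rw [F.map_comp, FintypeCat.comp_apply, hσ, ha']

end GaloisTransitive


end Literature.AnabelianGeometry.AbsoluteAnabelian
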